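import Summits.RiemannHypothesis.RiemannHypothesis.Theorems.PfPersistenceDefectiveTransportAnyBase
import HarnessLib

/-!
# Convexity is the no-cliffs hypothesis: under eventual convexity of the Weil bottom the
# speed / floor ladder of leaf G1.22 collapses (leaf G1.22 TRANSPORT, part 5)

pub-rhpf cell (mechanism/rigidity campaign; **no RH claims**), seat `pub-rhpf-transport-1` gen 5.
Companion of `PfPersistenceDefectiveTransportAnyBase.lean` (part 4).

Write `ε = weilGroundEnergy`.  Part 4 proved, RH-free and from any base `b > 0`:
speed limit at rate `δ` ⟹ eventual floor at rate `δ` ⟹ `|Re ρ − 1/2| ≤ δ/2`.  The converse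
"floor ⟹ speed limit" ("no cliffs": a floor on the DEPTH of the Weil bottom forces an a-priori
bound on the SPEED of its descent) is not known.  This file isolates the missing input as the
second-order shape hypothesis T-2 of the leaf (TRANSPORT.md §11): CONVEXITY of `a ↦ ε(a)` on a
half-line.

* `sub_le_mul_sub_of_convexOn` (real analysis): for `f` convex on `s ∋ x − 1, x + h`, `h > 0`:
  `f x − f (x + h) ≤ h · (f (x − 1) − f x)` — the drop over `[x, x+h]` is at most `h` times the drop
  over the unit interval to the LEFT (slopes of a convex function increase).
* `speedLimit_of_convexOn_of_floor`: if `ε` is convex on `[b, ∞)` (`b > 0`) and `ε(a) ≥ −C e^{κa}`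
  for `a ≥ b`, then the speed limit at rate `κ` holds from `b + 1` with constant `|ε b| + C`
  (uses the tree's `windowLipschitz_antitone`: `ε` is non-increasing).
* `speedLimit_of_convexOn_of_one_lt`: under convexity on `[b, ∞)` the speed limit holds RH-FREE at
  every rate `κ > 1` (the tree's unconditional floor `weilGroundEnergy_exp_lower_of_one_lt`, Solo).
* `eventually_floor_iff_eventually_speedLimit_of_convexOn`: under convexity on `[b, ∞)`, for every
  rate `κ > 0`: (eventual floor at rate `κ`) ⟺ (eventual speed limit at rate `κ`) — the exponent
  ladder `θ_S ≥ θ_K ≥ θ_D` of TRANSPORT.md §14 collapses to `θ_S = θ_D`.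
* `uniformSpeedLimit_of_convexOn_of_riemannHypothesis`: under convexity on `[b, ∞)`, RH gives the
  UNIFORM one-sided Lipschitz bound `ε x − ε (x + h) ≤ h · ε b` for `x ≥ b + 1`, `h > 0`; with part 4's
  `riemannHypothesis_of_subexpSpeed` this makes RH ⟺ (sub-exponential speed) under convexity
  (`riemannHypothesis_iff_subexpSpeed_of_convexOn`).

Nothing here asserts convexity of `ε`; it is a typed HYPOTHESIS (E1-type: content only as
`a → ∞`).  DATA (TRANSPORT.md §14 addendum): on the served ζ backbone the secant slopes of the
bottom are increasing on every same-`N` curve at spacing `≥ 0.004` (W1 caveat: window data cannot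
verify an asymptotic shape hypothesis).  References: E. Bombieri, *Remarks on Weil's quadratic
functional in the theory of prime numbers I*, Rend. Mat. Acc. Lincei (9) 11 (2000) 183–233, §4;
A. Connes, C. Consani, H. Moscovici, *Zeta spectral triples*, arXiv:2511.22755, Cor. 3.7–3.8
(monotonicity of the bottom; limit `0` ⟹ RH). [folklore]
-/

noncomputable section

set_option linter.dupNamespace false  -- D-0017 nested layout: `RiemannHypothesis.RiemannHypothesis`

namespace Summit.RiemannHypothesis.RiemannHypothesis.Theorems.PfPersistenceDefectiveTransport

open Set
open _root_.Literature.NumberTheory.LFunctions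
open _root_.Summit.RiemannHypothesis.RiemannHypothesis.Theorems.WeilWindowFlowWindowLipschitz
  (windowLipschitz_antitone)

/-! ## 1. Real analysis: a convex function has no cliffs -/

/-- **Slopes of a convex function increase**: the drop of `f` over `[x, x + h]` is at most `h` times
its drop over `[x − 1, x]`. [folklore] -/
theorem sub_le_mul_sub_of_convexOn {f : ℝ → ℝ} {s : Set ℝ} (hf : ConvexOn ℝ s f) {x h : ℝ}
    (hx : x - 1 ∈ s) (hxh : x + h ∈ s) (hh : 0 < h) :
    f x - f (x + h) ≤ h * (f (x - 1) - f x) := by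
  have key := hf.slope_mono_adjacent hx hxh (by linarith : x - 1 < x) (by linarith : x < x + h)
  have e1 : x - (x - 1) = 1 := by ring
  have e2 : x + h - x = h := by ring
  rw [e1, e2, div_one, le_div_iff₀ hh] at key
  linarith

/-! ## 2. Floor ⟹ speed limit under convexity -/

/-- **Convexity is the no-cliffs hypothesis.**  If `ε` is convex on `[b, ∞)` (`b > 0`) and has the
floor `ε(a) ≥ −C e^{κa}` for `a ≥ b` (`κ > 0`; no sign condition on `C`), then the SPEED LIMIT at rate `κ` holds from
`b + 1` with constant `|ε b| + C`: `ε x − ε (x + h) ≤ h ((|ε b| + C) e^{κx} + η)` for every `h ∈ (0, δ')`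
— indeed for `h = δ'/2`.  Proof: `ε x − ε (x+h) ≤ h (ε (x−1) − ε x) ≤ h (ε b + C e^{κx})`
(`windowLipschitz_antitone`).  CONDITIONAL; RH-free; no RH claim. [folklore] -/
theorem speedLimit_of_convexOn_of_floor {b κ C : ℝ} (hb : 0 < b) (hκ : 0 < κ)
    (hconv : ConvexOn ℝ (Ici b) weilGroundEnergy)
    (hfloor : ∀ a : ℝ, b ≤ a → -(C * Real.exp (κ * a)) ≤ weilGroundEnergy a) :
    ∀ x : ℝ, b + 1 ≤ x → ∀ η δ' : ℝ, 0 < η → 0 < δ' →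
      ∃ h : ℝ, 0 < h ∧ h < δ' ∧
        weilGroundEnergy x - weilGroundEnergy (x + h) ≤
          h * ((|weilGroundEnergy b| + C) * Real.exp (κ * x) + η) := by
  intro x hx η δ' hη hδ'
  refine ⟨δ' / 2, by linarith, by linarith, ?_⟩
  have hdrop := sub_le_mul_sub_of_convexOn hconv (x := x) (h := δ' / 2)
    (show x - 1 ∈ Ici b by simp only [mem_Ici]; linarith)
    (show x + δ' / 2 ∈ Ici b by simp only [mem_Ici]; linarith) (by linarith)
  have h1 : weilGroundEnergy (x - 1) ≤ weilGroundEnergy b := windowLipschitz_antitone hb (by linarith)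
  have h2 : weilGroundEnergy b ≤ |weilGroundEnergy b| := le_abs_self _
  have h3 : -(C * Real.exp (κ * x)) ≤ weilGroundEnergy x := hfloor x (by linarith)
  have h4 : 1 ≤ Real.exp (κ * x) := Real.one_le_exp (by nlinarith)
  have h5 : |weilGroundEnergy b| ≤ |weilGroundEnergy b| * Real.exp (κ * x) :=
    le_mul_of_one_le_right (abs_nonneg _) h4
  have h6 : weilGroundEnergy (x - 1) - weilGroundEnergy x ≤
      (|weilGroundEnergy b| + C) * Real.exp (κ * x) + η := by nlinarith
  have hδ2 : 0 ≤ δ' / 2 := by linarith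
  exact hdrop.trans (mul_le_mul_of_nonneg_left h6 hδ2)

/-- **Under eventual convexity the speed limit holds RH-free at every rate `κ > 1`** (where the floor
is the tree's unconditional `weilGroundEnergy_exp_lower_of_one_lt`; the strip conclusion of part 4 is
then empty, as it must be).  So under convexity `θ_S ≤ 1`.  CONDITIONAL on convexity; RH-free; no RH
claim. [folklore] -/
theorem speedLimit_of_convexOn_of_one_lt {b κ : ℝ} (hb : 0 < b) (hκ : 1 < κ)
    (hconv : ConvexOn ℝ (Ici b) weilGroundEnergy) :
    ∃ C' : ℝ, 0 ≤ C' ∧ ∀ x : ℝ, b + 1 ≤ x → ∀ η δ' : ℝ, 0 < η → 0 < δ' →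
      ∃ h : ℝ, 0 < h ∧ h < δ' ∧
        weilGroundEnergy x - weilGroundEnergy (x + h) ≤ h * (C' * Real.exp (κ * x) + η) := by
  obtain ⟨C, hC⟩ := weilGroundEnergy_exp_lower_of_one_lt hκ
  refine ⟨|weilGroundEnergy b| + max C 0, by positivity, ?_⟩
  refine speedLimit_of_convexOn_of_floor hb (by linarith) hconv fun a hba ↦ ?_
  have h1 := hC a (hb.trans_le hba)
  have h2 : C * Real.exp (κ * a) ≤ max C 0 * Real.exp (κ * a) :=
    mul_le_mul_of_nonneg_right (le_max_left _ _) (Real.exp_pos _).le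
  linarith

/-- **Ladder collapse under convexity.**  If `ε` is convex on `[b, ∞)` (`b > 0`), then for every rate
`κ > 0`: an EVENTUAL floor `ε(a) ≥ −C e^{κa}` exists iff an EVENTUAL speed limit at rate `κ` exists
(⟹: `speedLimit_of_convexOn_of_floor`; ⟸: part 4's `floor_of_defectiveLeakage`, which needs no
convexity).  With the tree's exact thermometer this reads: under convexity, the descent-speed
exponent of the Weil bottom IS the depth exponent (`θ_S = θ_D`), which is `≥ sup |2 Re ρ − 1|` and
equal to it under vertically sparse off-line zeros.  CONDITIONAL; RH-free; no RH claim. [folklore] -/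
theorem eventually_floor_iff_eventually_speedLimit_of_convexOn {b κ : ℝ} (hb : 0 < b) (hκ : 0 < κ)
    (hconv : ConvexOn ℝ (Ici b) weilGroundEnergy) :
    (∃ b' C : ℝ, b ≤ b' ∧ 0 ≤ C ∧ ∀ a : ℝ, b' ≤ a → -(C * Real.exp (κ * a)) ≤ weilGroundEnergy a) ↔
    (∃ b' C : ℝ, b ≤ b' ∧ 0 ≤ C ∧ ∀ x : ℝ, b' ≤ x → ∀ η δ' : ℝ, 0 < η → 0 < δ' →
      ∃ h : ℝ, 0 < h ∧ h < δ' ∧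
        weilGroundEnergy x - weilGroundEnergy (x + h) ≤ h * (C * Real.exp (κ * x) + η)) := by
  constructor
  · rintro ⟨b', C, hbb', hC, hfl⟩
    have hb' : 0 < b' := hb.trans_le hbb'
    have hconv' : ConvexOn ℝ (Ici b') weilGroundEnergy :=
      hconv.subset (Ici_subset_Ici.2 hbb') (convex_Ici _)
    exact ⟨b' + 1, |weilGroundEnergy b'| + C, by linarith, by positivity,
      speedLimit_of_convexOn_of_floor hb' hκ hconv' hfl⟩
  · rintro ⟨b', C, hbb', hC, hsp⟩
    have hb' : 0 < b' := hb.trans_le hbb'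
    obtain ⟨C', hC', hfl⟩ := floor_of_defectiveLeakage hb' hC hκ
      fun A _ ↦ ⟨0, le_rfl, fun x hx η δ' hη hδ' ↦ by simpa using hsp x hx.1 η δ' hη hδ'⟩
    exact ⟨b', C', hbb', hC', hfl⟩

/-! ## 3. Under convexity, RH gives a UNIFORM speed limit -/

/-- **RH + convexity ⟹ uniform one-sided Lipschitz bound.**  If `ε` is convex on `[b, ∞)` (`b > 0`)
and RH holds (so `ε ≥ 0`, `weilGroundEnergy_nonneg_of_riemannHypothesis`), then
`ε x − ε (x + h) ≤ h · ε b` for all `x ≥ b + 1`, `h > 0`.  CONDITIONAL (RH as hypothesis);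
proof.conditional; credits nothing; no RH claim. [folklore] -/
theorem uniformSpeedLimit_of_convexOn_of_riemannHypothesis (hRH : _root_.RiemannHypothesis)
    {b : ℝ} (hb : 0 < b) (hconv : ConvexOn ℝ (Ici b) weilGroundEnergy)
    {x h : ℝ} (hx : b + 1 ≤ x) (hh : 0 < h) :
    weilGroundEnergy x - weilGroundEnergy (x + h) ≤ h * weilGroundEnergy b := by
  have hdrop := sub_le_mul_sub_of_convexOn hconv (x := x) (h := h)
    (show x - 1 ∈ Ici b by simp only [mem_Ici]; linarith)
    (show x + h ∈ Ici b by simp only [mem_Ici]; linarith) hh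
  have h1 : weilGroundEnergy (x - 1) ≤ weilGroundEnergy b := windowLipschitz_antitone hb (by linarith)
  have h2 : 0 ≤ weilGroundEnergy x := weilGroundEnergy_nonneg_of_riemannHypothesis hRH (by linarith)
  have h3 : weilGroundEnergy (x - 1) - weilGroundEnergy x ≤ weilGroundEnergy b := by linarith
  exact hdrop.trans (mul_le_mul_of_nonneg_left h3 hh.le)

/-- **Under eventual convexity: RH ⟺ sub-exponential descent speed.**  If `ε` is convex on `[b, ∞)`
(`b > 0`), then RH holds iff for every `δ > 0` the speed limit at rate `δ` holds from some base with
some constant (⟹: the uniform bound `h · ε b`, and `ε b ≤ ε b · e^{δx}`; ⟸: part 4's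
`riemannHypothesis_of_subexpSpeed`, no convexity needed).  CONDITIONAL on convexity; no RH claim.
[folklore] -/
theorem riemannHypothesis_iff_subexpSpeed_of_convexOn {b : ℝ} (hb : 0 < b)
    (hconv : ConvexOn ℝ (Ici b) weilGroundEnergy) :
    _root_.RiemannHypothesis ↔
      ∀ δ : ℝ, 0 < δ → ∃ b' C : ℝ, 0 < b' ∧ 0 ≤ C ∧ ∀ x : ℝ, b' ≤ x → ∀ η δ' : ℝ, 0 < η → 0 < δ' →
        ∃ h : ℝ, 0 < h ∧ h < δ' ∧
          weilGroundEnergy x - weilGroundEnergy (x + h) ≤ h * (C * Real.exp (δ * x) + η) := by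
  constructor
  · intro hRH δ hδ
    have hεb : 0 ≤ weilGroundEnergy b := weilGroundEnergy_nonneg_of_riemannHypothesis hRH hb
    refine ⟨b + 1, weilGroundEnergy b, by linarith, hεb, fun x hx η δ' hη hδ' ↦ ?_⟩
    refine ⟨δ' / 2, by linarith, by linarith, ?_⟩
    have h1 := uniformSpeedLimit_of_convexOn_of_riemannHypothesis hRH hb hconv hx
      (by linarith : 0 < δ' / 2)
    have h2 : 1 ≤ Real.exp (δ * x) := Real.one_le_exp (by nlinarith)
    have h3 : weilGroundEnergy b ≤ weilGroundEnergy b * Real.exp (δ * x) :=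
      le_mul_of_one_le_right hεb h2
    have h4 : weilGroundEnergy b ≤ weilGroundEnergy b * Real.exp (δ * x) + η := by linarith
    exact h1.trans (mul_le_mul_of_nonneg_left h4 (by linarith))
  · exact fun h ↦ riemannHypothesis_of_subexpSpeed h

end Summit.RiemannHypothesis.RiemannHypothesis.Theorems.PfPersistenceDefectiveTransport

end
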